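import Summits.MatrixMultiplication.MatrixMultiplication.Theorems.SoloInformedCwTwoCertificates
import Literature.Barriers.MatrixMultiplication.LinearRankMethodBarrierProofs

/-!
# Refuting door D1 lies beyond the cactus barrier

Solo seat `solo-MatrixMultiplication-informed` (ideation tier, family 6), generation 3, 2026-08-19.

Door D1 is `asymptoticRank (cwTensor ℂ 2) ≤ 3 → MatrixMultiplication`. Its finitary form
(`asymptoticRank_cwTensor_two_le_three_iff_certificates`, this seat) says what a PROOF of the
hypothesis must exhibit: border-rank certificates `bR(T_{cw,2}^{⊠n}) ≤ (3+ε)^n` with `ε → 0`, none of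
them exact (`3^n < bR(T_{cw,2}^{⊠n})` at every level). This file records, in the kernel, what a
REFUTATION of the hypothesis must exhibit and why the only lower-bound technique that has ever been
applied to these tensors cannot deliver it:

* `three_lt_asymptoticRank_cwTensor_two_iff_exp_lower_bounds` — `R̃(T_{cw,2}) > 3` iff for ONE fixed
  `ε > 0` the exponential lower bound `(3+ε)^n < bR(T_{cw,2}^{⊠n})` holds at EVERY level `n ≥ 1`:
  super-linear border-rank lower bounds, `m^{1 + log₃(1+ε/3)}` in the format `m = 3^n`, for an explicit
  family of tensors;
* `linearRankMethod_threePowFormat_le` — the tree's PROVED cactus barrier (Buczyński 2026, Thm. 2 /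
  Cor. 13; Garg–Makam–Oliveira–Wigderson 2019, Cor. 8.5; `LinearRankMethodBarrier_holds`) specialised to
  the format `(ℂ^{3^n})^{⊗3}` of the Kronecker powers: every LINEAR rank method `L` (flattenings, Koszul
  and Young flattenings, Strassen's equations, catalecticants — the class that produced every known lower
  bound for powers of `T_{cw,2}`, Conner–Gesmundo–Landsberg–Ventura's `15` and `(1.75…)·3^n` included)
  with `rk ≤ k` on rank-one tensors has `rk L(t) ≤ k (6·3^n − 4)` on EVERY tensor `t` of the format;
* `linearRankMethod_certificate_lt_pow` — hence for every rate `ε > 0` there is a level `N(ε)` beyond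
  which no linear rank method certifies `(3+ε)^n` (`6·3^n − 4 < (3+ε)^n` once `n ε > 15`, Bernoulli);
* `cwTwo_door_two_sided` — summary: proving D1's hypothesis needs inexact certificates in the `o(n)`
  slack at infinitely many levels; refuting it needs exponential-rate lower bounds at all levels, which
  linear rank methods can certify at finitely many levels at most.

References. J. Buczyński, Cactus barriers, arXiv:2602.11309 (2026), Thm. 2, Cor. 13, §1.3;
A. Garg, V. Makam, R. Oliveira, A. Wigderson, More barriers for rank methods, via a "numeric to
symbolic" transfer, FOCS 2019 (arXiv:1904.04299), Thm. 8.4, Cor. 8.5; K. Efremenko, A. Garg,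
R. Oliveira, A. Wigderson, Barriers for rank methods in arithmetic complexity, ITCS 2018
(arXiv:1710.09502), Thm. 1.1; A. Conner, F. Gesmundo, J. M. Landsberg, E. Ventura, comput. complexity
31 (2022), Thm. 1.2, Prop. 3.2; J. M. Landsberg, Geometry and Complexity Theory, CUP 2017, §10.2.2.
-/

noncomputable section

namespace Summit.MatrixMultiplication.MatrixMultiplication.Theorems

open Literature.Computability.AlgebraicComplexity
open Literature.Barriers.MatrixMultiplication

/-! ## What a refutation of the door's hypothesis must exhibit -/

/-- **`R̃(T_{cw,2}) > 3` iff an exponential-rate border-rank lower bound holds at every level**: there is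
ONE `ε > 0` with `(3+ε)^n < bR(T_{cw,2}^{⊠n})` for all `n ≥ 1` (the negation of the seat's certificate
form of `R̃(T_{cw,2}) ≤ 3`). [cite: ConnerGesmundoLandsbergVentura2022, Prop. 3.2]
[cite: ChristandlVranaZuiddam2021, Rem. 20] -/
theorem three_lt_asymptoticRank_cwTensor_two_iff_exp_lower_bounds :
    3 < asymptoticRank (cwTensor ℂ 2) ↔
      ∃ ε : ℝ, 0 < ε ∧ ∀ n : ℕ, 0 < n →
        (3 + ε) ^ n < (algBorderRank (kroneckerPow (cwTensor ℂ 2) n) : ℝ) := by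
  rw [← not_le, asymptoticRank_cwTensor_two_le_three_iff_certificates]
  simp only [not_forall, not_exists, not_and, not_le, exists_prop]

/-! ## The cactus barrier in the format of the Kronecker powers -/

/-- `|[3]^n| = 3^n`: the format of `T_{cw,2}^{⊠n}`. [folklore] -/
theorem card_fin_fun_fin_three (n : ℕ) : Fintype.card (Fin n → Fin (2 + 1)) = 3 ^ n := by
  simp

/-- **The cactus barrier at the format `(ℂ^{3^n})^{⊗3}`** (the tree's proved
`LinearRankMethodBarrier_holds`, cube case `m = 3^n`): a linear rank method `L` into `p × q` matrices
with `rk L ≤ k` on rank-one tensors has `rk L(t) ≤ k (6·3^n − 4)` on every tensor `t` of the format —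
in particular on `T_{cw,2}^{⊠n}`. [cite: Buczynski2026, Thm. 2 and Cor. 13]
[cite: GargMakamOliveiraWigderson2019, Cor. 8.5] -/
theorem linearRankMethod_threePowFormat_le (n : ℕ) {p q : ℕ}
    (L : ((Fin n → Fin (2 + 1)) → (Fin n → Fin (2 + 1)) → (Fin n → Fin (2 + 1)) → ℂ) →ₗ[ℂ]
      Matrix (Fin p) (Fin q) ℂ) {k : ℕ}
    (hk : ∀ w u v : (Fin n → Fin (2 + 1)) → ℂ, (L (triad w u v)).rank ≤ k)
    (t : (Fin n → Fin (2 + 1)) → (Fin n → Fin (2 + 1)) → (Fin n → Fin (2 + 1)) → ℂ) :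
    (L t).rank ≤ k * (6 * 3 ^ n - 4) :=
  Buczynski2026_cactusBarrier_segre.cube LinearRankMethodBarrier_holds.cactus
    (Nat.one_le_pow n 3 (by norm_num))
    (card_fin_fun_fin_three n) (card_fin_fun_fin_three n) (card_fin_fun_fin_three n) L hk t

/-- The certificate form at `T_{cw,2}^{⊠n}`: the lower bound `rk L(T_{cw,2}^{⊠n}) / k` that a linear rank
method certifies for `bR(T_{cw,2}^{⊠n})` is at most `6·3^n − 4`. [cite: Buczynski2026, Thm. 2] -/
theorem linearRankMethod_certificate_kroneckerPow_cwTensor_two_le (n : ℕ) {p q : ℕ}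
    (L : ((Fin n → Fin (2 + 1)) → (Fin n → Fin (2 + 1)) → (Fin n → Fin (2 + 1)) → ℂ) →ₗ[ℂ]
      Matrix (Fin p) (Fin q) ℂ) {k : ℕ}
    (hk : ∀ w u v : (Fin n → Fin (2 + 1)) → ℂ, (L (triad w u v)).rank ≤ k) :
    (L (kroneckerPow (cwTensor ℂ 2) n)).rank / k ≤ 6 * 3 ^ n - 4 :=
  Nat.div_le_of_le_mul (linearRankMethod_threePowFormat_le n L hk _)

/-! ## The rate a refutation needs versus the rate the barrier allows -/

/-- Bernoulli: `6·3^n − 4 < (3+ε)^n` as soon as `n ε > 15`. [folklore] -/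
theorem six_mul_three_pow_sub_four_lt_pow {ε : ℝ} (hε : 0 < ε) {n : ℕ} (hn : 15 / ε < n) :
    (6 * 3 ^ n - 4 : ℝ) < (3 + ε) ^ n := by
  have h1 : (3 + ε) ^ n = 3 ^ n * (1 + ε / 3) ^ n := by
    rw [← mul_pow]; congr 1; ring
  have hB : 1 + (n : ℝ) * (ε / 3) ≤ (1 + ε / 3) ^ n :=
    one_add_mul_le_pow (by linarith [hε.le]) n
  have hnε : 15 < (n : ℝ) * ε := (div_lt_iff₀ hε).1 hn
  have h3 : (0 : ℝ) < 3 ^ n := by positivity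
  calc (6 * 3 ^ n - 4 : ℝ) < 6 * 3 ^ n := by linarith
    _ ≤ 3 ^ n * (1 + n * (ε / 3)) := by nlinarith
    _ ≤ 3 ^ n * (1 + ε / 3) ^ n := mul_le_mul_of_nonneg_left hB h3.le
    _ = (3 + ε) ^ n := h1.symm

/-- For every rate `ε > 0`: `6·3^n − 4 < (3+ε)^n` for all large `n`. [folklore] -/
theorem exists_forall_six_mul_three_pow_sub_four_lt_pow {ε : ℝ} (hε : 0 < ε) :
    ∃ N : ℕ, ∀ n : ℕ, N ≤ n → (6 * 3 ^ n - 4 : ℝ) < (3 + ε) ^ n := by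
  obtain ⟨N, hN⟩ := exists_nat_gt (15 / ε)
  exact ⟨N, fun n hn => six_mul_three_pow_sub_four_lt_pow hε (hN.trans_le (by exact_mod_cast hn))⟩

/-- **Linear rank methods cannot certify a refutation of the door.** For every rate `ε > 0` there is a
level `N` such that at every level `n ≥ N`, for every linear rank method `L` (any matrix format, any
`k ≥` its rank on rank-one tensors) and every tensor `t` of the format of `T_{cw,2}^{⊠n}`, the certified
bound `rk L(t) / k` is `< (3+ε)^n`. A refutation of D1's hypothesis must certify exactly such bounds at
ALL levels for one fixed `ε` (`three_lt_asymptoticRank_cwTensor_two_iff_exp_lower_bounds`), hence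
outside this class at all but finitely many of them. [cite: Buczynski2026, Thm. 2, Cor. 13 and §1.3]
[cite: GargMakamOliveiraWigderson2019, Cor. 8.5] [cite: EfremenkoGargOliveiraWigderson2018, Thm. 1.1] -/
theorem linearRankMethod_certificate_lt_pow {ε : ℝ} (hε : 0 < ε) :
    ∃ N : ℕ, ∀ n : ℕ, N ≤ n → ∀ (p q : ℕ)
      (L : ((Fin n → Fin (2 + 1)) → (Fin n → Fin (2 + 1)) → (Fin n → Fin (2 + 1)) → ℂ) →ₗ[ℂ]
        Matrix (Fin p) (Fin q) ℂ) (k : ℕ),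
      (∀ w u v : (Fin n → Fin (2 + 1)) → ℂ, (L (triad w u v)).rank ≤ k) →
        ∀ t, (((L t).rank / k : ℕ) : ℝ) < (3 + ε) ^ n := by
  obtain ⟨N, hN⟩ := exists_forall_six_mul_three_pow_sub_four_lt_pow hε
  refine ⟨N, fun n hn p q L k hk t => ?_⟩
  have h4 : 4 ≤ 6 * 3 ^ n := by
    have := Nat.one_le_pow n 3 (by norm_num)
    omega
  have h1 : (L t).rank / k ≤ 6 * 3 ^ n - 4 :=
    Nat.div_le_of_le_mul (linearRankMethod_threePowFormat_le n L hk t)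
  have h2 : (((L t).rank / k : ℕ) : ℝ) ≤ ((6 * 3 ^ n - 4 : ℕ) : ℝ) := by exact_mod_cast h1
  have h3 : ((6 * 3 ^ n - 4 : ℕ) : ℝ) = 6 * 3 ^ n - 4 := by
    rw [Nat.cast_sub h4]; norm_num
  calc (((L t).rank / k : ℕ) : ℝ) ≤ ((6 * 3 ^ n - 4 : ℕ) : ℝ) := h2
    _ = 6 * 3 ^ n - 4 := h3
    _ < (3 + ε) ^ n := hN n hn

/-! ## Summary: both halves of the door are outside present technique -/

/-- **Door D1, two-sided.** (i) PROVING the hypothesis `R̃(T_{cw,2}) ≤ 3`: no level is exact,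
`3^n < bR(T_{cw,2}^{⊠n})` for every `n ≥ 1`, so the certificates `bR ≤ (3+ε)^n` must be found in the
`o(n)` slack along `n → ∞`; (ii) REFUTING it is equivalent to one exponential-rate lower bound
`(3+ε)^n < bR(T_{cw,2}^{⊠n})` at every level; (iii) for every rate `ε > 0`, beyond some level no linear
rank method certifies `(3+ε)^n` on the format of `T_{cw,2}^{⊠n}` (cactus barrier, proved in the tree).
[cite: ConnerGesmundoLandsbergVentura2022, Thm. 1.2 (iii), Prop. 3.2] [cite: Buczynski2026, Thm. 2]
[cite: GargMakamOliveiraWigderson2019, Cor. 8.5] -/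
theorem cwTwo_door_two_sided :
    (∀ n : ℕ, 1 ≤ n → 3 ^ n < algBorderRank (kroneckerPow (cwTensor ℂ 2) n)) ∧
    (3 < asymptoticRank (cwTensor ℂ 2) ↔
      ∃ ε : ℝ, 0 < ε ∧ ∀ n : ℕ, 0 < n →
        (3 + ε) ^ n < (algBorderRank (kroneckerPow (cwTensor ℂ 2) n) : ℝ)) ∧
    (∀ ε : ℝ, 0 < ε → ∃ N : ℕ, ∀ n : ℕ, N ≤ n → ∀ (p q : ℕ)
      (L : ((Fin n → Fin (2 + 1)) → (Fin n → Fin (2 + 1)) → (Fin n → Fin (2 + 1)) → ℂ) →ₗ[ℂ]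
        Matrix (Fin p) (Fin q) ℂ) (k : ℕ),
      (∀ w u v : (Fin n → Fin (2 + 1)) → ℂ, (L (triad w u v)).rank ≤ k) →
        (((L (kroneckerPow (cwTensor ℂ 2) n)).rank / k : ℕ) : ℝ) < (3 + ε) ^ n) :=
  ⟨fun _ hn => three_pow_lt_algBorderRank_kroneckerPow_cwTensor_two hn,
    three_lt_asymptoticRank_cwTensor_two_iff_exp_lower_bounds,
    fun _ hε => by
      obtain ⟨N, hN⟩ := linearRankMethod_certificate_lt_pow hε
      exact ⟨N, fun n hn p q L k hk => hN n hn p q L k hk _⟩⟩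

end Summit.MatrixMultiplication.MatrixMultiplication.Theorems

end
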